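import Literature.MathematicalPhysics.QuantumLattice.FermionConditionalFreeEnergyCertificate
import Literature.MathematicalPhysics.QuantumLattice.HubbardJordanWignerLocality
import Literature.InformationTheory.Entropy.EntropyTensorAdditivity
import HarnessLib

/-!
# Entropy of fermionic product states across an initial-segment cut: `S(Γσ₁ · Γσ_A) = S(σ₁) + S(σ_A)`

Topic `MathematicalPhysics/QuantumLattice`, namespace `Literature.MathematicalPhysics.QuantumLattice`.

Let the site order of `Λ₂` be split as an INITIAL segment `ι : Λ₁ ↪o Λ₂` followed by a FINAL segment
`j : A ↪ Λ₂` (`ε : Λ₂ ≃ A ⊕ Λ₁`, `ι = inr ≫ ε⁻¹`, `j = inl ≫ ε⁻¹`). For a density matrix `σ₁` on the Fock space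
over `Λ₁` and an EVEN density matrix `σ_A` over `A`, the fermionic product state
`ρ = Γ_ι(σ₁) · Γ_j(σ_A) ∈ 𝔄_{Λ₂}` is, in the Jordan–Wigner product coordinates of
`FermionConditionalFreeEnergyCertificate.lean` (`splitProdEquiv ε`), the Kronecker product
`toSpin σ_A ⊗ₖ toSpin σ₁` — `Γ_ι` is canonical on the initial segment
(`toSpin_fermionEmbed_of_strictMono_of_isLowerSet`) and `Γ_j` is canonical on EVEN operators over the
order-convex final segment (`toSpin_fermionEmbed_of_even`: the Jordan–Wigner strings of an even monomial
cancel). Hence (`vonNeumannEntropy_kronecker`, `EntropyTensorAdditivity.lean`)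

* `fermionProduct_submatrix_splitProdEquiv` — `ρ` in product coordinates is `toSpin σ_A ⊗ₖ toSpin σ₁`;
* `posSemidef_fermionProduct`, `trace_fermionProduct` — `ρ` is a density matrix;
* `vonNeumannEntropy_fermionProduct` — **`S(ρ) = S(σ₁) + S(σ_A)`**.

Iterating along a chain of initial segments (boxes stacked along the slow lexicographic coordinate are
order intervals) gives the entropy of a product of even box states as the sum of the box entropies — with
unitary invariance (`vonNeumannEntropy_unitary_conj`) the entropy bookkeeping of a DRESSED box tiling
`W (∏_b Γσ_b) W⋆`, i.e. the free-energy trial states of the thermal «f⁺ lever» (Gibbs variational principle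
with `S = Σ_b S(σ_b) ≥ Σ_b −log tr σ_b²`). Everything is PROVED; no definition, no named fact.

References: Araki–Moriya 2003 §4.1–4.3 (product states of even states on local CAR algebras)
[ArakiMoriya2003]; Evans–Kawahigashi 1998 §6.5 (Jordan–Wigner canonical on even algebras)
[EvansKawahigashi1998]; Nielsen–Chuang 2010 §11.3.4 eq. (11.58) (additivity of entropy) [NielsenChuang2010].
-/

noncomputable section

namespace Literature.MathematicalPhysics.QuantumLattice

open Matrix Finset HubbardWave0
open scoped ComplexOrder Kronecker
open Literature.InformationTheory.Entropy (vonNeumannEntropy vonNeumannEntropy_submatrix_equiv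
  vonNeumannEntropy_kronecker)

section Split

open JordanWigner

variable {A Λ₁ Λ₂ : Type} [LinearOrder A] [Fintype A] [LinearOrder Λ₁] [Fintype Λ₁] [LinearOrder Λ₂]
  [Fintype Λ₂]

/-- A Fock-space matrix read in product coordinates is its Jordan–Wigner image relabelled along `ε`
and read on pairs (re-derived; private in `FermionConditionalFreeEnergyCertificate`). [folklore] -/
private theorem submatrix_splitProdEquiv_eq' (ε : Λ₂ ≃ A ⊕ Λ₁) (M : Matrix (Finset (Orb Λ₂)) (Finset (Orb Λ₂)) ℂ) :
    M.submatrix (splitProdEquiv ε) (splitProdEquiv ε) =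
      (reindexOp ε (toSpin M)).submatrix
        (Equiv.sumArrowEquivProdArrow A Λ₁ (Fin 4)).symm (Equiv.sumArrowEquivProdArrow A Λ₁ (Fin 4)).symm := by
  ext p p'
  simp only [Matrix.submatrix_apply, reindexOp_apply, toSpin_apply, splitProdEquiv, Equiv.trans_apply,
    JordanWigner.configEquiv_apply]
  rfl

/-- **The lower factor in product coordinates**: `Γ_inr N ↦ 𝟙 ⊗ N` (spin picture, pairs
`(configuration of A) × (configuration of Λ₁)`). [cite: NielsenChuang2010, §2.1.7 eq. (2.50)] -/
theorem submatrix_reindexOp_spinEmbed_inr (ε : Λ₂ ≃ A ⊕ Λ₁) (ι : Λ₁ ↪ Λ₂)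
    (hιε : ι = (Function.Embedding.inr : Λ₁ ↪ A ⊕ Λ₁).trans ε.symm.toEmbedding) (N : Op Λ₁ 4) :
    (reindexOp ε (spinEmbed ι N)).submatrix
        (Equiv.sumArrowEquivProdArrow A Λ₁ (Fin 4)).symm (Equiv.sumArrowEquivProdArrow A Λ₁ (Fin 4)).symm =
      (1 : Matrix (A → Fin 4) (A → Fin 4) ℂ) ⊗ₖ N := by
  ext ⟨pa, p1⟩ ⟨qa, q1⟩
  rw [Matrix.submatrix_apply, reindexOp_apply, spinEmbed_apply, Matrix.kroneckerMap_apply, Matrix.one_apply]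
  have hι : ∀ x, ε (ι x) = Sum.inr x := fun x => by rw [hιε]; simp
  have harg : ∀ (p : (A → Fin 4) × (Λ₁ → Fin 4)),
      (fun x => (Equiv.sumArrowEquivProdArrow A Λ₁ (Fin 4)).symm p (ε (ι x))) = p.2 := by
    intro p; funext x; rw [hι]; rfl
  rw [harg, harg]
  have hrange : ∀ y : Λ₂, y ∉ Set.range ι ↔ ∃ a, ε y = Sum.inl a := by
    intro y
    constructor
    · intro hy
      rcases h : ε y with a | x
      · exact ⟨a, rfl⟩
      · exact absurd ⟨x, by rw [hιε]; simp [← h]⟩ hy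
    · rintro ⟨a, ha⟩ ⟨x, rfl⟩
      rw [hι] at ha
      exact Sum.inr_ne_inl ha
  by_cases hpq : pa = qa
  · subst hpq
    rw [if_pos, if_pos rfl, one_mul]
    intro y hy
    obtain ⟨a, ha⟩ := (hrange y).1 hy
    have : y = ε.symm (Sum.inl a) := by rw [← ha, Equiv.symm_apply_apply]
    subst this
    simp
  · rw [if_neg, if_neg hpq, zero_mul]
    intro h
    apply hpq
    funext a
    have := h (ε.symm (Sum.inl a)) ((hrange _).2 ⟨a, by simp⟩)
    simpa using this

/-- **The upper factor in product coordinates**: `Γ_inl M ↦ M ⊗ 𝟙`. [cite: NielsenChuang2010, §2.1.7 eq. (2.50)] -/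
theorem submatrix_reindexOp_spinEmbed_inl (ε : Λ₂ ≃ A ⊕ Λ₁) (j : A ↪ Λ₂)
    (hjε : j = (Function.Embedding.inl : A ↪ A ⊕ Λ₁).trans ε.symm.toEmbedding) (M : Op A 4) :
    (reindexOp ε (spinEmbed j M)).submatrix
        (Equiv.sumArrowEquivProdArrow A Λ₁ (Fin 4)).symm (Equiv.sumArrowEquivProdArrow A Λ₁ (Fin 4)).symm =
      M ⊗ₖ (1 : Matrix (Λ₁ → Fin 4) (Λ₁ → Fin 4) ℂ) := by
  ext ⟨pa, p1⟩ ⟨qa, q1⟩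
  rw [Matrix.submatrix_apply, reindexOp_apply, spinEmbed_apply, Matrix.kroneckerMap_apply, Matrix.one_apply]
  have hj : ∀ a, ε (j a) = Sum.inl a := fun a => by rw [hjε]; simp
  have harg : ∀ (p : (A → Fin 4) × (Λ₁ → Fin 4)),
      (fun a => (Equiv.sumArrowEquivProdArrow A Λ₁ (Fin 4)).symm p (ε (j a))) = p.1 := by
    intro p; funext a; rw [hj]; rfl
  rw [harg, harg]
  have hrange : ∀ y : Λ₂, y ∉ Set.range j ↔ ∃ x, ε y = Sum.inr x := by
    intro y
    constructor
    · intro hy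
      rcases h : ε y with a | x
      · exact absurd ⟨a, by rw [hjε]; simp [← h]⟩ hy
      · exact ⟨x, rfl⟩
    · rintro ⟨x, hx⟩ ⟨a, rfl⟩
      rw [hj] at hx
      exact Sum.inl_ne_inr hx
  by_cases hpq : p1 = q1
  · subst hpq
    rw [if_pos, if_pos rfl, mul_one]
    intro y hy
    obtain ⟨x, hx⟩ := (hrange y).1 hy
    have : y = ε.symm (Sum.inr x) := by rw [← hx, Equiv.symm_apply_apply]
    subst this
    simp
  · rw [if_neg, if_neg hpq, mul_zero]
    intro h
    apply hpq
    funext x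
    have := h (ε.symm (Sum.inr x)) ((hrange _).2 ⟨x, by simp⟩)
    simpa using this

omit [LinearOrder A] [Fintype A] [Fintype Λ₁] [Fintype Λ₂] in
/-- The range of the final segment `j = inl ≫ ε⁻¹` complementary to an initial segment is order-convex.
[folklore] -/
private theorem ordConnected_range_of_split (ι : Λ₁ ↪o Λ₂) (hι : IsLowerSet (Set.range ι)) (ε : Λ₂ ≃ A ⊕ Λ₁)
    (hιε : ι.toEmbedding = (Function.Embedding.inr : Λ₁ ↪ A ⊕ Λ₁).trans ε.symm.toEmbedding) (j : A ↪ Λ₂)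
    (hjε : j = (Function.Embedding.inl : A ↪ A ⊕ Λ₁).trans ε.symm.toEmbedding) :
    (Set.range j).OrdConnected := by
  -- the range of `j` is the complement of the range of `ι`, an upper set
  have hcompl : Set.range j = (Set.range ι)ᶜ := by
    ext y
    simp only [Set.mem_range, Set.mem_compl_iff]
    constructor
    · rintro ⟨a, rfl⟩ ⟨x, hx⟩
      have h1 : ε (ι x) = Sum.inr x := by
        have := congrArg (fun f : Λ₁ ↪ Λ₂ => f x) hιε
        simp only [Function.Embedding.trans_apply, Equiv.coe_toEmbedding] at this
        change ι x = ε.symm (Sum.inr x) at this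
        rw [this, Equiv.apply_symm_apply]
      have h2 : ε (j a) = Sum.inl a := by rw [hjε]; simp
      rw [hx] at h1
      rw [h1] at h2
      exact Sum.inr_ne_inl h2
    · intro hy
      rcases h : ε y with a | x
      · exact ⟨a, by rw [hjε]; simp [← h]⟩
      · exact absurd ⟨x, by
          have := congrArg (fun f : Λ₁ ↪ Λ₂ => f x) hιε
          simp only [Function.Embedding.trans_apply, Equiv.coe_toEmbedding] at this
          change ι x = ε.symm (Sum.inr x) at this
          rw [this, ← h, Equiv.symm_apply_apply]⟩ hy
  rw [hcompl]
  exact (hι.compl).ordConnected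

/-- **A fermionic product state in product coordinates.** Initial segment `ι = inr ≫ ε⁻¹`, final segment
`j = inl ≫ ε⁻¹`, any `σ₁` over `Λ₁`, EVEN `σ_A` over `A`: `(Γ_ι σ₁ · Γ_j σ_A)` read on pairs is
`toSpin σ_A ⊗ₖ toSpin σ₁`. [cite: ArakiMoriya2003, §4.1] [cite: EvansKawahigashi1998, §6.5 Fig. 6.2] -/
theorem fermionProduct_submatrix_splitProdEquiv (ι : Λ₁ ↪o Λ₂) (hι : IsLowerSet (Set.range ι))
    (ε : Λ₂ ≃ A ⊕ Λ₁)
    (hιε : ι.toEmbedding = (Function.Embedding.inr : Λ₁ ↪ A ⊕ Λ₁).trans ε.symm.toEmbedding)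
    (j : A ↪ Λ₂) (hj : StrictMono j)
    (hjε : j = (Function.Embedding.inl : A ↪ A ⊕ Λ₁).trans ε.symm.toEmbedding)
    (σ₁ : Matrix (Finset (Orb Λ₁)) (Finset (Orb Λ₁)) ℂ) {σA : Matrix (Finset (Orb A)) (Finset (Orb A)) ℂ}
    (hev : parityAut σA = σA) :
    (fermionEmbed ι.toEmbedding σ₁ * fermionEmbed j σA).submatrix (splitProdEquiv ε) (splitProdEquiv ε) =
      toSpin σA ⊗ₖ toSpin σ₁ := by
  rw [submatrix_splitProdEquiv_eq', map_mul, map_mul,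
    toSpin_fermionEmbed_of_strictMono_of_isLowerSet ι.toEmbedding ι.strictMono hι,
    toSpin_fermionEmbed_of_even j hj (ordConnected_range_of_split ι hι ε hιε j hjε) hev,
    ← Matrix.submatrix_mul_equiv _ _ _ (Equiv.sumArrowEquivProdArrow A Λ₁ (Fin 4)).symm _,
    submatrix_reindexOp_spinEmbed_inr ε ι.toEmbedding hιε,
    submatrix_reindexOp_spinEmbed_inl ε j hjε, ← Matrix.mul_kronecker_mul, Matrix.one_mul, Matrix.mul_one]

/-- **A fermionic product state is positive semidefinite** (product coordinates: a Kronecker product of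
positive semidefinite matrices). [cite: ArakiMoriya2003, §4.3] -/
theorem posSemidef_fermionProduct (ι : Λ₁ ↪o Λ₂) (hι : IsLowerSet (Set.range ι)) (ε : Λ₂ ≃ A ⊕ Λ₁)
    (hιε : ι.toEmbedding = (Function.Embedding.inr : Λ₁ ↪ A ⊕ Λ₁).trans ε.symm.toEmbedding)
    (j : A ↪ Λ₂) (hj : StrictMono j)
    (hjε : j = (Function.Embedding.inl : A ↪ A ⊕ Λ₁).trans ε.symm.toEmbedding)
    {σ₁ : Matrix (Finset (Orb Λ₁)) (Finset (Orb Λ₁)) ℂ} {σA : Matrix (Finset (Orb A)) (Finset (Orb A)) ℂ}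
    (hσ₁ : σ₁.PosSemidef) (hσA : σA.PosSemidef) (hev : parityAut σA = σA) :
    (fermionEmbed ι.toEmbedding σ₁ * fermionEmbed j σA).PosSemidef := by
  refine (Matrix.posSemidef_submatrix_equiv (splitProdEquiv ε)).1 ?_
  rw [fermionProduct_submatrix_splitProdEquiv ι hι ε hιε j hj hjε σ₁ hev]
  exact ((posSemidef_toSpin_iff σA).2 hσA).kronecker ((posSemidef_toSpin_iff σ₁).2 hσ₁)

/-- **Trace of a fermionic product state**: `tr(Γσ₁ · Γσ_A) = tr σ_A · tr σ₁`. [cite: ArakiMoriya2003, §4.3] -/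
theorem trace_fermionProduct (ι : Λ₁ ↪o Λ₂) (hι : IsLowerSet (Set.range ι)) (ε : Λ₂ ≃ A ⊕ Λ₁)
    (hιε : ι.toEmbedding = (Function.Embedding.inr : Λ₁ ↪ A ⊕ Λ₁).trans ε.symm.toEmbedding)
    (j : A ↪ Λ₂) (hj : StrictMono j)
    (hjε : j = (Function.Embedding.inl : A ↪ A ⊕ Λ₁).trans ε.symm.toEmbedding)
    (σ₁ : Matrix (Finset (Orb Λ₁)) (Finset (Orb Λ₁)) ℂ) {σA : Matrix (Finset (Orb A)) (Finset (Orb A)) ℂ}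
    (hev : parityAut σA = σA) :
    (fermionEmbed ι.toEmbedding σ₁ * fermionEmbed j σA).trace = σA.trace * σ₁.trace := by
  rw [← trace_submatrix_equiv_equiv (fermionEmbed ι.toEmbedding σ₁ * fermionEmbed j σA) (splitProdEquiv ε),
    fermionProduct_submatrix_splitProdEquiv ι hι ε hιε j hj hjε σ₁ hev, Matrix.trace_kronecker, trace_toSpin,
    trace_toSpin]

/-- **Additivity of the von Neumann entropy over a fermionic product state.** Initial segment `ι`, final
segment `j`, density matrices `σ₁` (over `Λ₁`) and `σ_A` (over `A`, EVEN):
`S(Γ_ι σ₁ · Γ_j σ_A) = S(σ₁) + S(σ_A)`. [cite: NielsenChuang2010, §11.3.4 eq. (11.58)]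
[cite: ArakiMoriya2003, §4.3] -/
theorem vonNeumannEntropy_fermionProduct (ι : Λ₁ ↪o Λ₂) (hι : IsLowerSet (Set.range ι)) (ε : Λ₂ ≃ A ⊕ Λ₁)
    (hιε : ι.toEmbedding = (Function.Embedding.inr : Λ₁ ↪ A ⊕ Λ₁).trans ε.symm.toEmbedding)
    (j : A ↪ Λ₂) (hj : StrictMono j)
    (hjε : j = (Function.Embedding.inl : A ↪ A ⊕ Λ₁).trans ε.symm.toEmbedding)
    {σ₁ : Matrix (Finset (Orb Λ₁)) (Finset (Orb Λ₁)) ℂ} {σA : Matrix (Finset (Orb A)) (Finset (Orb A)) ℂ}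
    (hσ₁ : σ₁.IsHermitian) (htr₁ : σ₁.trace = 1) (hσA : σA.IsHermitian) (htrA : σA.trace = 1)
    (hev : parityAut σA = σA) :
    vonNeumannEntropy (fermionEmbed ι.toEmbedding σ₁ * fermionEmbed j σA) =
      vonNeumannEntropy σ₁ + vonNeumannEntropy σA := by
  have hherm : (fermionEmbed ι.toEmbedding σ₁ * fermionEmbed j σA).IsHermitian := by
    have h := (isHermitian_toSpin_iff σA).2 hσA
    have h1 := (isHermitian_toSpin_iff σ₁).2 hσ₁
    have hk : (toSpin σA ⊗ₖ toSpin σ₁).IsHermitian := by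
      rw [Matrix.IsHermitian, Matrix.conjTranspose_kronecker, h.eq, h1.eq]
    rw [← fermionProduct_submatrix_splitProdEquiv ι hι ε hιε j hj hjε σ₁ hev] at hk
    have := hk.submatrix (splitProdEquiv ε).symm
    simpa using this
  rw [← vonNeumannEntropy_submatrix_equiv hherm (splitProdEquiv ε),
    fermionProduct_submatrix_splitProdEquiv ι hι ε hιε j hj hjε σ₁ hev,
    vonNeumannEntropy_kronecker ((isHermitian_toSpin_iff σA).2 hσA) ((isHermitian_toSpin_iff σ₁).2 hσ₁)
      (by rw [trace_toSpin, htrA]) (by rw [trace_toSpin, htr₁]),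
    vonNeumannEntropy_toSpin hσA, vonNeumannEntropy_toSpin hσ₁, add_comm]

end Split

/-! ### §2. Regions of `ℤ^d` split at a lexicographic cut (e.g. boxes stacked along the slow coordinate) -/

section Cut

open Literature.Probability.LatticeModels

variable {d : ℕ}

/-- The lower part of a region, as an order embedding of ordered site sets. [folklore] -/
def lowerInclO (Λl Λu : Finset (Site d)) : PolySite Λl ↪o PolySite (Λl ∪ Λu) :=
  OrderEmbedding.ofStrictMono (PolySite.incl Finset.subset_union_left) fun _ _ h => h

/-- `lowerInclO` is the isotony embedding `PolySite.incl`. [cite: ArakiMoriya2003, §4.1 Def. 4.1 (2)] -/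
theorem lowerInclO_toEmbedding (Λl Λu : Finset (Site d)) :
    (lowerInclO Λl Λu).toEmbedding = PolySite.incl (Finset.subset_union_left : Λl ⊆ Λl ∪ Λu) :=
  DFunLike.ext _ _ fun _ => rfl

/-- If every site of `Λl` is lexicographically below every site of `Λu`, then `Λl` is an initial segment
of `Λl ∪ Λu` (the «one-sided lattice» situation of the Jordan–Wigner transformation).
[cite: EvansKawahigashi1998, §6.5 Fig. 6.2(b)] -/
theorem isLowerSet_range_lowerInclO {Λl Λu : Finset (Site d)}
    (hcut : ∀ x ∈ Λl, ∀ y ∈ Λu, toLex x < toLex y) : IsLowerSet (Set.range (lowerInclO Λl Λu)) := by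
  rintro y z hzy ⟨x, rfl⟩
  have hzΛ : ofLex z.1 ∈ Λl ∪ Λu := PolySite.ofLex_mem z
  rcases Finset.mem_union.1 hzΛ with hz | hz
  · exact ⟨PolySite.pt (ofLex z.1) hz, Subtype.ext rfl⟩
  · exfalso
    have hx : ofLex (x : PolySite Λl).1 ∈ Λl := PolySite.ofLex_mem x
    have hlt := hcut _ hx _ hz
    rw [toLex_ofLex, toLex_ofLex] at hlt
    exact absurd hzy (not_le.2 hlt)

/-- The site bijection `Λl ∪ Λu ≃ Λu ⊔ Λl` for disjoint parts (the upper part FIRST, matching the product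
coordinates `(configuration of the upper part) × (configuration of the lower part)`). [folklore] -/
def cutSplitEquiv {Λl Λu : Finset (Site d)} (hdisj : Disjoint Λl Λu) :
    PolySite (Λl ∪ Λu) ≃ PolySite Λu ⊕ PolySite Λl where
  toFun y :=
    if h : ofLex y.1 ∈ Λu then Sum.inl (PolySite.pt (ofLex y.1) h)
    else Sum.inr (PolySite.pt (ofLex y.1) ((Finset.mem_union.1 (PolySite.ofLex_mem y)).resolve_right h))
  invFun := Sum.elim (fun z => PolySite.incl Finset.subset_union_right z)
    (fun z => PolySite.incl Finset.subset_union_left z)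
  left_inv y := by
    by_cases h : ofLex y.1 ∈ Λu
    · simp only [h, dite_true, Sum.elim_inl]; rfl
    · simp only [h, dite_false, Sum.elim_inr]; rfl
  right_inv z := by
    rcases z with z | z
    · have hz : ofLex (z : PolySite Λu).1 ∈ Λu := PolySite.ofLex_mem z
      have h1 : ofLex (PolySite.incl (Finset.subset_union_right : Λu ⊆ Λl ∪ Λu) z).1 ∈ Λu := hz
      simp only [Sum.elim_inl, h1, dite_true]; rfl
    · have hz : ofLex (z : PolySite Λl).1 ∈ Λl := PolySite.ofLex_mem z
      have h1 : ¬ ofLex (PolySite.incl (Finset.subset_union_left : Λl ⊆ Λl ∪ Λu) z).1 ∈ Λu :=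
        fun h => Finset.disjoint_left.1 hdisj hz h
      simp only [Sum.elim_inr, h1, dite_false]; rfl

/-- Through the split, the lower part is the second summand. [folklore] -/
private theorem lowerInclO_eq_inr_trans {Λl Λu : Finset (Site d)} (hdisj : Disjoint Λl Λu) :
    (lowerInclO Λl Λu).toEmbedding =
      (Function.Embedding.inr : PolySite Λl ↪ PolySite Λu ⊕ PolySite Λl).trans (cutSplitEquiv hdisj).symm.toEmbedding :=
  DFunLike.ext _ _ fun _ => rfl

/-- Through the split, the upper part is the first summand. [folklore] -/
private theorem upperIncl_eq_inl_trans {Λl Λu : Finset (Site d)} (hdisj : Disjoint Λl Λu) :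
    PolySite.incl (Finset.subset_union_right : Λu ⊆ Λl ∪ Λu) =
      (Function.Embedding.inl : PolySite Λu ↪ PolySite Λu ⊕ PolySite Λl).trans (cutSplitEquiv hdisj).symm.toEmbedding :=
  DFunLike.ext _ _ fun _ => rfl

/-- The upper inclusion is strictly monotone. [folklore] -/
private theorem strictMono_upperIncl (Λl Λu : Finset (Site d)) :
    StrictMono (PolySite.incl (Finset.subset_union_right : Λu ⊆ Λl ∪ Λu)) := fun _ _ h => h

/-- **Additivity of entropy across a lexicographic cut.** Let `Λl, Λu ⊆ ℤ^d` be finite with every site of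
`Λl` lexicographically below every site of `Λu` (e.g. boxes stacked along the slow coordinate), `σl ∈ 𝔄_{Λl}`
and `σu ∈ 𝔄_{Λu}` density matrices with `σu` EVEN. Then the product state
`ρ = Γ_{Λl ⊆ Λ} σl · Γ_{Λu ⊆ Λ} σu ∈ 𝔄_{Λl ∪ Λu}` has `S(ρ) = S(σl) + S(σu)`.
[cite: NielsenChuang2010, §11.3.4 eq. (11.58)] [cite: ArakiMoriya2003, §4.3] -/
theorem vonNeumannEntropy_fermionProduct_of_cut {Λl Λu : Finset (Site d)}
    (hcut : ∀ x ∈ Λl, ∀ y ∈ Λu, toLex x < toLex y)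
    {σl : FermionOp Λl} {σu : FermionOp Λu} (hσl : σl.IsHermitian) (htrl : σl.trace = 1)
    (hσu : σu.IsHermitian) (htru : σu.trace = 1) (hev : parityAut σu = σu) :
    vonNeumannEntropy (fermionEmbed (PolySite.incl (Finset.subset_union_left : Λl ⊆ Λl ∪ Λu)) σl *
        fermionEmbed (PolySite.incl (Finset.subset_union_right : Λu ⊆ Λl ∪ Λu)) σu) =
      vonNeumannEntropy σl + vonNeumannEntropy σu := by
  have hdisj : Disjoint Λl Λu := Finset.disjoint_left.2 fun x hx hx' => lt_irrefl _ (hcut x hx x hx')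
  rw [← lowerInclO_toEmbedding]
  exact vonNeumannEntropy_fermionProduct (lowerInclO Λl Λu) (isLowerSet_range_lowerInclO hcut)
    (cutSplitEquiv hdisj) (lowerInclO_eq_inr_trans hdisj) _ (strictMono_upperIncl Λl Λu)
    (upperIncl_eq_inl_trans hdisj) hσl htrl hσu htru hev

/-- **The product state across a lexicographic cut is a density matrix**: positive semidefinite, and of trace
`tr σu · tr σl`. [cite: ArakiMoriya2003, §4.3] -/
theorem posSemidef_fermionProduct_of_cut {Λl Λu : Finset (Site d)}
    (hcut : ∀ x ∈ Λl, ∀ y ∈ Λu, toLex x < toLex y)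
    {σl : FermionOp Λl} {σu : FermionOp Λu} (hσl : σl.PosSemidef) (hσu : σu.PosSemidef)
    (hev : parityAut σu = σu) :
    (fermionEmbed (PolySite.incl (Finset.subset_union_left : Λl ⊆ Λl ∪ Λu)) σl *
        fermionEmbed (PolySite.incl (Finset.subset_union_right : Λu ⊆ Λl ∪ Λu)) σu).PosSemidef ∧
      (fermionEmbed (PolySite.incl (Finset.subset_union_left : Λl ⊆ Λl ∪ Λu)) σl *
          fermionEmbed (PolySite.incl (Finset.subset_union_right : Λu ⊆ Λl ∪ Λu)) σu).trace =
        σu.trace * σl.trace := by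
  have hdisj : Disjoint Λl Λu := Finset.disjoint_left.2 fun x hx hx' => lt_irrefl _ (hcut x hx x hx')
  rw [← lowerInclO_toEmbedding]
  exact ⟨posSemidef_fermionProduct (lowerInclO Λl Λu) (isLowerSet_range_lowerInclO hcut) (cutSplitEquiv hdisj)
      (lowerInclO_eq_inr_trans hdisj) _ (strictMono_upperIncl Λl Λu) (upperIncl_eq_inl_trans hdisj) hσl hσu hev,
    trace_fermionProduct (lowerInclO Λl Λu) (isLowerSet_range_lowerInclO hcut) (cutSplitEquiv hdisj)
      (lowerInclO_eq_inr_trans hdisj) _ (strictMono_upperIncl Λl Λu) (upperIncl_eq_inl_trans hdisj) σl hev⟩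

end Cut

end Literature.MathematicalPhysics.QuantumLattice

end
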